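import Summits.ResolutionOfSingularities.ResolutionOfSingularities.Theorems.WeightedInvariantELadderAssembly

/-!
# THE ABSTRACT LADDER ASSEMBLY WITH A UNIVERSE-POLYMORPHIC MEASURE (ORDER (o54-b))

`ELadder.ladder_assembly` (file `…WeightedInvariantELadderAssembly`, p538492) runs the strong induction on a
well-founded measure `μ : Stage k → W` with `W : Type`; the door's rung `e = 2` reads its measure in
`Ordinal.{0} : Type 1` (`Stage.mu₂ ι`, file `…WeightedInvariantELadderTwoStage`), and a `Type`-valued lemma does not
specialise upward.  This file re-proves the SAME statement with `{W : Type u}` — binders byte-identical to the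
registrar's target text `L/res-L1-w43-plan-1/o54b_ladder_assembly_measure.lean` (sha16 7d039af8170b2169), proof
the same `WellFoundedLT.induction` along the cobordant tower as `ladder_assembly` (one admissible centre from
`centre`, the tree's quotient step `DatumToEmbedded.quotientStep_of_isRegularWeightedCentre`, a blow-up of the
quotient from `exists_isBlowup`, the successor stage, `succ` for the invariant and the measure drop, the induction
hypothesis, and one more `AdmissiblyResolvableIn` step).

CONSUMER: door skeleton v3.10 `e2_assembly … := ELadder.ladder_assembly_measure (W := Ordinal.{0}) Stage.InvDim₂
(Stage.mu₂ ι) (fun S R => Stage.IsCanonicalCentre₂ ι J S R) …` (DOOR item stmt-ResolutionOfSingularities-19897,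
E2 tier).

[OURS · L1 W4.3 · door tier E2 · pure port, scheme-light]  A theorem about OUR typed objects (`ELadderOne.Stage`,
`HypersurfacePair.Resolvable`); the cited source is the blueprint of the induction, not a restated theorem.
-/

set_option linter.dupNamespace false -- mandated namespace of this single-conjunct summit

open CategoryTheory AlgebraicGeometry TopologicalSpace IsLocalRing
open Literature.AlgebraicGeometry.Resolution
open Summit.ResolutionOfSingularities.ResolutionOfSingularities.Theorems
open Summit.ResolutionOfSingularities.ResolutionOfSingularities.Theorems.ELadderOne

namespace Summit.ResolutionOfSingularities.ResolutionOfSingularities.Theorems.ELadder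

/-- **THE ABSTRACT LADDER ASSEMBLY, universe-polymorphic measure (ORDER (o54-b)).**  Let `Inv` be a property of
stages, `μ` a measure of stages with values in a type `W : Type u` (any universe) whose `<` is well founded, and
`Good S R` an opaque property of Rees-algebra data on the ambient of a stage.  Suppose (CENTRE) every singular stage
with `Inv` carries an ADMISSIBLE centre `R` with the generic point of the hypersurface OFF its support and
`Good S R`, and (SUCCESSOR) for every such `S, R` and every Rees filtration `R'` with `R'.ideal = R.piece` the
successor stage built by the tree's quotient step satisfies `Inv` and has strictly smaller `μ`.  Then EVERY stage
with `Inv` has a resolvable hypersurface pair — strong induction on `μ S` along the cobordant tower; the text of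
`ELadder.ladder_assembly` verbatim with `{W : Type}` generalised to `{W : Type u}` (the door's rung `e = 2` takes
`W := Ordinal.{0}`). [cite: Wlodarczyk2022, §2.3.3, Thm 1.1.4 (5)] -/
theorem ladder_assembly_measure.{u} {k : Type} [Field k] [PerfectField k] {W : Type u} [LT W] [WellFoundedLT W]
    (Inv : Stage k → Prop) (μ : Stage k → W) (Good : (S : Stage k) → ReesAlgebraData S.Y → Prop)
    (centre : ∀ S : Stage k, Inv S → ¬ Scheme.IsRegular S.X →
      ∃ R : ReesAlgebraData S.Y, IsAdmissibleCentre S.f S.i.ker R ∧ S.i (genericPoint S.X) ∉ R.support ∧ Good S R)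
    (succ : ∀ (S : Stage k), Inv S → ¬ Scheme.IsRegular S.X →
      ∀ (R : ReesAlgebraData S.Y), IsAdmissibleCentre S.f S.i.ker R → S.i (genericPoint S.X) ∉ R.support →
        Good S R → ∀ (R' : ReesFiltration S.Y), R'.ideal = R.piece →
      ∀ [Smooth (R'.πPlus ≫ S.f)] [IsSeparated (R'.πPlus ≫ S.f)] [QuasiCompact (R'.πPlus ≫ S.f)]
        [IsIntegral (R'.strictTransformPlus S.i.ker).subscheme]
        (hlp' : IsLocallyPrincipal (R'.strictTransformPlus S.i.ker).subschemeι.ker)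
        (V' : Scheme.{0}) (ρ : V' ⟶ S.V) [IsIntegral V'] [IsProper ρ]
        (q' : (R'.strictTransformPlus S.i.ker).subscheme ⟶ V')
        (hq' : q' ≫ ρ ≫ S.g = (R'.strictTransformPlus S.i.ker).subschemeι ≫ R'.πPlus ≫ S.f)
        (𝒜' : GradedAtlas (S.j + 1) (R'.πPlus ≫ S.f) (R'.strictTransformPlus S.i.ker).subschemeι q'),
        Inv ⟨R'.plus, R'.πPlus ≫ S.f, (R'.strictTransformPlus S.i.ker).subscheme,
            (R'.strictTransformPlus S.i.ker).subschemeι, hlp', V', q', ρ ≫ S.g, hq', S.j + 1, 𝒜'⟩ ∧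
          μ ⟨R'.plus, R'.πPlus ≫ S.f, (R'.strictTransformPlus S.i.ker).subscheme,
            (R'.strictTransformPlus S.i.ker).subschemeι, hlp', V', q', ρ ≫ S.g, hq', S.j + 1, 𝒜'⟩ < μ S)
    (S : Stage k) (hInv : Inv S) : S.toPair.Resolvable := by
  suffices h : ∀ (m : W) (S : Stage k), Inv S → μ S = m → S.toPair.Resolvable from
    h _ S hInv rfl
  intro m
  induction m using WellFoundedLT.induction with
  | ind m ih =>
  intro S hInv hm
  by_cases hreg : Scheme.IsRegular S.X
  · -- resolved: no step
    exact HypersurfacePair.resolvable_of_isRegular _ ((isRegular_iff_isRegular_image S.i).mp hreg)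
  · -- one admissible step, then the induction hypothesis at the successor stage
    obtain ⟨R, hadm, hξ, hgood⟩ := centre S hInv hreg
    have hc : R.IsRegularWeightedCentre := hadm.1
    haveI : IsLocallyNoetherian S.Y := LocallyOfFiniteType.isLocallyNoetherian S.f
    have hY : Scheme.IsRegular S.Y := Scheme.IsRegular.of_smooth S.f (Scheme.isRegular_Spec (.of k))
    -- the Rees filtration of the centre and the successor ambient
    let R' : ReesFiltration S.Y :=
      { ideal := R.piece
        ideal_zero := R.piece_zero
        antitone := antitone_piece hc
        mul_le := R.piece_mul_le }
    obtain ⟨hsm', hsep', hqc'⟩ :=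
      WeightedThesis.GlobalCobordantPlus.smooth_πPlus_comp_of_isRegularWeightedCentre S.f R hc R' rfl
    haveI := hsm'; haveI := hsep'; haveI := hqc'
    obtain ⟨hint', hker⟩ :=
      DatumToEmbedded.StrictTransform.isIntegral_strictTransformPlus_of_not_mem_support S.i R hc R' rfl hξ
    haveI := hint'
    set I' := R'.strictTransformPlus S.i.ker with hI'
    have hI'lp : IsLocallyPrincipal I' :=
      WeightedThesis.HypersurfacePreserved.isLocallyPrincipal_strictTransformPlus hY R hc R' rfl S.i.ker
        S.isLocallyPrincipal
    let i' := I'.subschemeι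
    have hlp' : IsLocallyPrincipal i'.ker := by
      rw [Scheme.IdealSheafData.ker_subschemeι]; exact hI'lp
    let σX : I'.subscheme ⟶ S.X := IsClosedImmersion.lift S.i (i' ≫ R'.πPlus) hker
    have hσX : σX ≫ S.i = i' ≫ R'.πPlus := IsClosedImmersion.lift_fac _ _ _
    -- (hom) of the admissible centre on the charts of the presentation, then the tree's quotient step
    have hH := hadm.2.2
    have hhom : ∀ (a : S.atlas.ι) (n : ℕ), @Ideal.IsHomogeneous (Fin S.j → ℤ)
        (AddSubgroup Γ(S.Y, S.atlas.W a)) Γ(S.Y, S.atlas.W a) _ _ _ (S.atlas.piece a) _ _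
        (S.atlas.gradedRing a) ((R.piece n).ideal (S.atlas.W a)) := fun a n =>
      @hH S.j (S.atlas.W a) (S.atlas.piece a) (S.atlas.gradedRing a) (S.atlas.appLE_mem a)
        (S.atlas.isHomogeneous_ker a) n
    obtain ⟨K, hK, hstep⟩ := DatumToEmbedded.quotientStep_of_isRegularWeightedCentre S.f S.i S.q S.g
      S.hq S.atlas R hc hξ hhom R' rfl σX hσX
    obtain ⟨V', ρ, hρ⟩ := exists_isBlowup S.V K
    haveI : IsLocallyNoetherian S.V := LocallyOfFiniteType.isLocallyNoetherian S.g
    haveI : IsProper ρ := hρ.isProper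
    haveI : IsIntegral V' := hρ.isIntegral hK
    obtain ⟨q', hq', ⟨𝒜'⟩⟩ := hstep V' ρ hρ
    have hq'' : q' ≫ ρ ≫ S.g = i' ≫ R'.πPlus ≫ S.f := by
      rw [← Category.assoc, hq', Category.assoc, S.hq, ← Category.assoc, hσX, Category.assoc]
    -- the successor stage: invariant and measure drop
    let S' : Stage k :=
      { Y := R'.plus, f := R'.πPlus ≫ S.f, X := (R'.strictTransformPlus S.i.ker).subscheme,
        i := (R'.strictTransformPlus S.i.ker).subschemeι, isLocallyPrincipal := hlp',
        V := V', q := q', g := ρ ≫ S.g, hq := hq'', j := S.j + 1, atlas := 𝒜' }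
    obtain ⟨hInv', hlt⟩ : Inv S' ∧ μ S' < μ S :=
      succ S hInv hreg R hadm hξ hgood R' rfl hlp' V' ρ q' hq'' 𝒜'
    -- the induction hypothesis resolves the successor
    obtain ⟨n, hn⟩ := ih _ (hm ▸ hlt) S' hInv' rfl
    -- one more step for `S`
    refine ⟨n + 1, R, hadm, R', rfl, hsm', hsep', hqc', hI'lp, hint', ?_⟩
    have e : (@HypersurfacePair.mk k _ R'.plus (R'.πPlus ≫ S.f) hsm' hsep' hqc' I' hI'lp hint') =
        S'.toPair := by
      simp only [S', Stage.toPair, HypersurfacePair.ofKer]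
      congr 1
      exact (Scheme.IdealSheafData.ker_subschemeι I').symm
    rw [← e] at hn
    exact hn

end Summit.ResolutionOfSingularities.ResolutionOfSingularities.Theorems.ELadder
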